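import Summits.BirchSwinnertonDyer.BirchSwinnertonDyer.Theorems.GenusKolyvaginAtTwoK4NegBetaFrameDeepPrimeSupplyMinus
import Summits.BirchSwinnertonDyer.BirchSwinnertonDyer.Theorems.GenusKolyvaginAtTwoK4NegBetaFrameDeepPrimeSupplyFrame
import Summits.BirchSwinnertonDyer.BirchSwinnertonDyer.Theorems.GenusKolyvaginAtTwoK4NegPhantomCellDescentBit
import Summits.BirchSwinnertonDyer.BirchSwinnertonDyer.Theorems.GenusKolyvaginAtTwoK4NegBetaFrameOneBitDescent
import Literature.NumberTheory.EllipticCurves.HeegnerPointsKolyvaginPrimaryLeavesProofs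
import HarnessLib

/-!
# Route `GenusKolyvaginAtTwo`, crux K₄⁻ `K4Neg` (stmt-BirchSwinnertonDyer-31526), the (β)-residual F4ᶠ —
# THE (β)-SUPPLY ONE LEVEL UP IN THE `K`-SIDE CURRENCY of the LEAD's `hHalf` (points of `E(K)`, `Γ_K`, Frobenius at `λ`)

Width seat `bsd-line-gk2-p5` g43 (cell `bsd-f1-sign2`), WIDTH-5 attach on route `GenusKolyvaginAtTwo` rev 59, lane «the (β)-residual of K₄⁻».
`--supports stmt-BirchSwinnertonDyer-31526 --as helper`.  THEOREMS ONLY (no definition, no named fact, no `sorry`); standard axioms.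
**BSD is NOT proved by this file; `K4Neg` is NOT proved; no item is closed by it.**

The minus-case supply (`…BetaFrameDeepPrimeSupplyMinus`, gk2-p5 g43) is stated on `E(ℚ̄)` with `Γ_ℚ` acting.  The (β)-frame data of the LEAD road
(`PlusDescent.kFourNeg_conclusion_of_bsdp_pair_of_halvingBit`: `hHalf`) and of gk2-p3 g34 (`PhantomDescentBit.not_hHalf_iff_exists_kummer_eq_resTorsion`)
live on `E(K̄)` with `Γ_K` acting: a `K`-point `R`, a half `Q'` fixed by `Γ_{K(E[4])}`.  THIS FILE transports along gk2-p3's dictionary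
`θ = RatClosure.pointsEquiv` (`θ(res g · P) = g · θ P`, `θ(c₀ · P) = c_*(θ P)` for the lift of complex conjugation) and states the supply there:

★★★ `exists_kolyvaginPrime_deep_smul_sub_ne_of_kFrame` — `E/ℚ` globally minimal with `ρ̄_{E,2}` onto and `Δ < 0`, `K` imaginary quadratic with
non-trivial automorphism `c`, `c₀` a complex conjugation; `R ∈ E(K)` with `c·R = −R` (the twin's generator read in `E(K)⁻`), `Q' ∈ E(K̄)` a half of `R`
FIXED by `Γ_{K(E[4])}` (the (β) bit: `hHalf`'s hypothesis holds non-trivially), `Q` a half of `Q'` MOVED by some element of `Γ_{K(E[4])}` (automatic when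
`R ∉ 2E(K)`: `OneBitDescent.forall_exists_torsionFixing_smul_ne_of_not_two_dvd`).  Then beyond every bound there is a prime `ℓ` with
`Zhang2014.IsKolyvaginPrime (W.conductorNorm ℤ) W K 2 ℓ ∧ 2 ≤ kolyvaginIndex W 2 ℓ ∧ FrobEqFrobInfty W K 4 ℓ` (K4Neg's witness-prime binders, one level
up), a place `w ∋ ℓ` of `K` and an arithmetic Frobenius `τ ∈ Γ_K` at `w` with **`τ·Q − Q ≠ 0`** — i.e. `[κ₄(R), Frob_λ] ≠ 0`: the level-`4` Kummer class
of `R` is ALIVE at the deep prime `λ` (`H¹_ur(K_λ, E[4]) = E[4]`).  Companion `…_of_kFrame_of_not_two_dvd`: the «quarter moved» input discharged from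
`R ∉ 2E(K)` on the frame.

READING (census; nothing closed).  This is the exact (β)-counterpart of gk2-p3 g34's (α)-supply `exists_alive_primeFrame_of_phantom_selmer`: there the
phantom `ξ_E` itself is alive at the steered prime; here, where every deep prime is blind to `ξ_E`, its HALVING `κ₄(R)` is alive at a supplied deep prime.
What Kolyvagin's first step then yields is `c(ℓ) ≠ 0` at level `2^{M₀+2}` (Q2), one bit short of primitivity.  BSD is NOT proved by any of this.

References: [McCallumLMS1991] §3 Cor. 3.2; [GrossLMS1991] §3 (3.2)–(3.3), §9 Prop. 9.1, 9.6; [MazurRubin2010] Lemma 3.5; [LawsonWuthrich2016] §3, §7.1;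
[SilvermanAEC2009] VIII.§2.
-/

set_option linter.dupNamespace false -- `Summit.<P>.<Sub>` repeats `BirchSwinnertonDyer` (D-0017)
set_option autoImplicit false

noncomputable section

open scoped Classical Pointwise

namespace Summit.BirchSwinnertonDyer.BirchSwinnertonDyer.Theorems.GenusExact.Lw2PhantomExclusion.DeepPrimeOneBit

open WeierstrassCurve Field NumberField IsDedekindDomain
open Literature.NumberTheory.GaloisRepresentations Literature.NumberTheory.EllipticCurves
open Literature.NumberTheory
open Rat.HeightOneSpectrum
open Summit.BirchSwinnertonDyer.BirchSwinnertonDyer.Theorems.GenusKolyTwistingPrime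
open Summit.BirchSwinnertonDyer.BirchSwinnertonDyer.Theorems.GenusExact.PhantomDescentBit

variable (W : WeierstrassCurve ℚ) [W.IsElliptic] [W.IsGloballyMinimal] [NeZero (W.conductorNorm ℤ)]
  {K : Type} [Field K] [NumberField K]

/-- ★★★ **THE (β)-SUPPLY ONE LEVEL UP, `K`-SIDE CURRENCY.**  See the module docstring.  [cite: McCallumLMS1991, §3 Cor. 3.2]
[cite: GrossLMS1991, §3 (3.2)–(3.3), §9 Prop. 9.6] [cite: MazurRubin2010, Lemma 3.5] [cite: LawsonWuthrich2016, §7.1] -/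
theorem exists_kolyvaginPrime_deep_smul_sub_ne_of_kFrame (hK : IsImaginaryQuadratic K)
    (hsurj : W.HasSurjectiveModNGaloisRep 2) (hΔ : W.Δ < 0)
    {c₀ : absoluteGaloisGroup ℚ} (hc₀ : IsComplexConjugation (Rat.castHom ℝ) c₀) {c : K ≃ₐ[ℚ] K} (hc : c ≠ 1)
    (R : (W.baseChange K).toAffine.Point) (hcR : c • R = -R)
    (Q' Q : geomPoints (W.baseChange K)) (hQ' : (2 : ℤ) • Q' = toGeomPoints (W.baseChange K) R) (hQ : (2 : ℤ) • Q = Q')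
    (hent : ∀ ρ ∈ torsionFixing (W.baseChange K) ((2 ^ 2 : ℕ) : ℤ), ρ • Q' = Q')
    (hN : ∃ ρ ∈ torsionFixing (W.baseChange K) ((2 ^ 2 : ℕ) : ℤ), ρ • Q ≠ Q) (b : ℕ) :
    ∃ ℓ : ℕ, b < ℓ ∧ Zhang2014.IsKolyvaginPrime (W.conductorNorm ℤ) W K 2 ℓ ∧ 2 ≤ Zhang2014.kolyvaginIndex W 2 ℓ ∧
      FrobEqFrobInfty W K (2 ^ 2) ℓ ∧
      ∃ (w : HeightOneSpectrum (𝓞 K)) (𝔔 : Ideal (absIntegers (𝓞 K) K)) (τ : absoluteGaloisGroup K),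
        (ℓ : 𝓞 K) ∈ w.asIdeal ∧ 𝔔 ∈ w.primesAbove ∧ IsArithFrobAt (𝓞 K) τ 𝔔 ∧ τ • Q - Q ≠ 0 := by
  classical
  haveI : Fact (Nat.Prime 2) := ⟨Nat.prime_two⟩
  haveI : Algebra.IsQuadraticExtension ℚ K := ⟨hK.1⟩
  haveI : IsTotallyComplex K := hK.2
  haveI hell : (W.baseChange K).IsElliptic := inferInstanceAs ((W.map (algebraMap ℚ K)).IsElliptic)
  -- ### the transport `θ : E(ℚ̄) ≃ E(K̄)` and the `Γ_ℚ`-side points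
  set θ := RatClosure.pointsEquiv (K := K) W with hθ
  set RQ : geomPoints W := θ.symm (toGeomPoints (W.baseChange K) R) with hRQ
  set Q'Q : geomPoints W := θ.symm Q' with hQ'Q
  set QQ : geomPoints W := θ.symm Q with hQQ
  have hθR : θ RQ = toGeomPoints (W.baseChange K) R := θ.apply_symm_apply _
  have hQ'Q2 : (2 : ℤ) • Q'Q = RQ := by rw [hQ'Q, hRQ, ← map_zsmul, hQ']
  have hQQ2 : (2 : ℤ) • QQ = Q'Q := by rw [hQQ, hQ'Q, ← map_zsmul, hQ]
  -- `Γ_K` fixes `R`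
  have hresR : ∀ g : absoluteGaloisGroup K, absGaloisRestrict ℚ K g • RQ = RQ := fun g ↦ by
    rw [hRQ, ← pointsEquiv_symm_smul, smul_toGeomPoints]
  -- `c₀ · R = −R` (through the lift of `c`)
  set t : AlgebraicClosure K ≃+* AlgebraicClosure K := (absGaloisTransport (K := ℚ) (L := K) c₀).toRingEquiv with ht_def
  have ht : IsLiftOfAut c t := RatClosure.isLiftOfAut_absGaloisTransport_of_isImaginaryQuadratic hK hc hc₀
  have hc₀R : c₀ • RQ = -RQ := by
    apply θ.injective
    rw [RatClosure.pointsEquiv_smul_of_lift W ht c₀ (fun _ ↦ rfl), hθR, IsLiftOfAut.pointsMap_toGeomPoints, map_neg, hθR,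
      ← WeierstrassCurve.smul_def, hcR, map_neg]
  -- every `σ ∈ Γ_ℚ` acts on `R` by `±1`
  have hc1 : c₀ * c₀ = 1 := by rw [← sq]; exact hc₀.sq_eq_one
  have hHi := index_range_absGaloisRestrict_eq_finrank ℚ K
  have hidx2 : ((absGaloisRestrict ℚ K).range).index = 2 := hHi.trans hK.1
  have hc₀H : c₀ ∉ (absGaloisRestrict ℚ K).range := hc₀.not_mem_range_absGaloisRestrict (L := K) IsTotallyComplex.isComplex
  have hR : ∀ σ : absoluteGaloisGroup ℚ, σ • RQ = RQ ∨ σ • RQ = -RQ := by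
    intro σ
    by_cases hσ : σ ∈ (absGaloisRestrict ℚ K).range
    · obtain ⟨g, rfl⟩ := hσ
      exact Or.inl (hresR g)
    · right
      have hcσ : c₀ * σ ∈ (absGaloisRestrict ℚ K).range := by
        rw [Subgroup.mul_mem_iff_of_index_two hidx2]
        exact ⟨fun h ↦ absurd h hc₀H, fun h ↦ absurd h hσ⟩
      obtain ⟨g, hg⟩ := hcσ
      have hg' : absGaloisRestrict ℚ K g = c₀ * σ := hg
      have h1 : (c₀ * σ) • RQ = RQ := by rw [← hg']; exact hresR g
      have h2 : σ = c₀ * (c₀ * σ) := by rw [← mul_assoc, hc1, one_mul]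
      rw [h2, mul_smul, h1, hc₀R]
  -- ### the hypotheses of the minus-case supply
  have hce : ∃ e : geomPoints W, (2 : ℤ) • e = 0 ∧ c₀ • e ≠ e := by
    obtain ⟨e, he⟩ := KolyvaginEigenTwo.exists_twoTorsion_smul_ne_of_Δ_neg W hΔ hc₀
    refine ⟨e, (WeierstrassCurve.mem_geomTorsion_iff W (2 : ℤ) _).mp e.2, fun hcon ↦ he (Subtype.ext ?_)⟩
    rw [AddSubgroup.torsionBy.coe_smul]; exact hcon
  have hirr : ∀ m : geomPoints W, (2 : ℤ) • m = 0 → m ≠ 0 → ∃ σ : absoluteGaloisGroup ℚ, σ • m ≠ m := by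
    intro m hm hm0
    by_contra hcon
    push Not at hcon
    have hmT : m ∈ geomTorsion W (2 : ℤ) := (WeierstrassCurve.mem_geomTorsion_iff W (2 : ℤ) m).mpr hm
    have h0 : (⟨m, hmT⟩ : geomTorsion W (2 : ℤ)) = 0 :=
      eq_zero_of_forall_smul_eq W hsurj fun σ ↦ Subtype.ext (by rw [AddSubgroup.torsionBy.coe_smul]; exact hcon σ)
    exact hm0 (by simpa using congrArg Subtype.val h0)
  -- `res` carries `Γ_{K(E_K[4])}` into `Γ_{ℚ(E[4])}`
  have hresT : ∀ ρ ∈ torsionFixing (W.baseChange K) ((2 ^ 2 : ℕ) : ℤ), absGaloisRestrict ℚ K ρ ∈ torsionFixing W ((2 ^ 2 : ℕ) : ℤ) := by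
    intro ρ hρ
    refine (mem_torsionFixing_iff W _).mpr fun P ↦ ?_
    apply (RatClosure.torsionEquiv (K := K) W ((2 ^ 2 : ℕ) : ℤ)).injective
    rw [RatClosure.torsionEquiv_smul, smul_eq_of_mem_torsionFixing (W.baseChange K) _ hρ]
  -- and back: an element of `Γ_{ℚ(E[4])} ∩ Γ_K` is `res` of an element of `Γ_{K(E_K[4])}`
  have hresT' : ∀ g : absoluteGaloisGroup K, absGaloisRestrict ℚ K g ∈ torsionFixing W ((2 ^ 2 : ℕ) : ℤ) →
      g ∈ torsionFixing (W.baseChange K) ((2 ^ 2 : ℕ) : ℤ) := by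
    intro g hg
    refine (mem_torsionFixing_iff (W.baseChange K) _).mpr fun P ↦ ?_
    obtain ⟨P₀, rfl⟩ := (RatClosure.torsionEquiv (K := K) W ((2 ^ 2 : ℕ) : ℤ)).surjective P
    rw [← RatClosure.torsionEquiv_smul, smul_eq_of_mem_torsionFixing W _ hg]
  -- the canonical subgroup `H = Γ_{ℚ(E[4])} ⊓ Γ_K ⊓ Stab Q'`
  set H : Subgroup (absoluteGaloisGroup ℚ) := torsionFixing W ((2 ^ 2 : ℕ) : ℤ) ⊓ (absGaloisRestrict ℚ K).range ⊓
    MulAction.stabilizer (absoluteGaloisGroup ℚ) Q'Q with hHdef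
  have hHopen : IsOpen (H : Set (absoluteGaloisGroup ℚ)) := by
    rw [hHdef, Subgroup.coe_inf, Subgroup.coe_inf]
    exact ((isOpen_torsionFixing W (by positivity)).inter (isOpen_range_absGaloisRestrict K)).inter
      (W.isOpen_stabilizer_point_holds Q'Q)
  have hK' : ∀ γ : absoluteGaloisGroup ℚ, γ ∈ (absGaloisRestrict ℚ K).range ↔ ∀ x : K, γ • absEmbedding ℚ K x = absEmbedding ℚ K x :=
    fun γ ↦ mem_range_absGaloisRestrict_iff_smul_absEmbedding (F := ℚ) (M := K) γ
  have hHW : ∀ γ ∈ H, ∀ P : geomTorsion W ((2 ^ 2 : ℕ) : ℤ), γ • P = P := fun γ hγ P ↦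
    smul_eq_of_mem_torsionFixing W _ hγ.1.1 P
  have hH4 : ∀ γ ∈ H, ∀ P : geomPoints W, (4 : ℤ) • P = 0 → γ • P = P := fun γ hγ P hP ↦ by
    have := hHW γ hγ ⟨P, (WeierstrassCurve.mem_geomTorsion_iff W _ P).mpr (by exact_mod_cast hP)⟩
    simpa only [AddSubgroup.torsionBy.coe_smul] using congrArg Subtype.val this
  have hHK : ∀ γ ∈ H, ∀ x : K, γ • absEmbedding ℚ K x = absEmbedding ℚ K x := fun γ hγ ↦ (hK' γ).mp hγ.1.2
  have hHQ' : ∀ γ ∈ H, γ • Q'Q = Q'Q := fun γ hγ ↦ hγ.2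
  haveI hRn : ((absGaloisRestrict ℚ K).range).Normal := Subgroup.normal_of_index_eq_two hidx2
  have hHn : ∀ (σ : absoluteGaloisGroup ℚ), ∀ γ ∈ H, σ * γ * σ⁻¹ ∈ H := by
    intro σ γ hγ
    have hQ'fix : (σ * γ * σ⁻¹) • Q'Q = Q'Q := by
      rcases hR σ with hσ | hσ
      · exact (conj_smul_sub_eq W (hH4 γ hγ) hQ'Q2 hQQ2 (hHQ' γ hγ) hσ).2.1
      · exact (conj_smul_sub_eq_of_smul_eq_neg' W (hH4 γ hγ) hQ'Q2 hQQ2 (hHQ' γ hγ) hσ).2.1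
    exact ⟨⟨(torsionFixing_normal W _).conj_mem γ hγ.1.1 σ, hRn.conj_mem γ hγ.1.2 σ⟩, hQ'fix⟩
  -- the element moving `Q`
  have hN' : ∃ γ₀ ∈ H, γ₀ • QQ ≠ QQ := by
    obtain ⟨ρ, hρT, hρQ⟩ := hN
    refine ⟨absGaloisRestrict ℚ K ρ, ⟨⟨hresT ρ hρT, ⟨ρ, rfl⟩⟩, ?_⟩, ?_⟩
    · change absGaloisRestrict ℚ K ρ • Q'Q = Q'Q
      rw [hQ'Q, ← pointsEquiv_symm_smul, hent ρ hρT]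
    · rw [hQQ, ← pointsEquiv_symm_smul]
      exact fun h ↦ hρQ (θ.symm.injective h)
  -- ### the minus-case supply, and the transport of its conclusion back to `E(K̄)`
  obtain ⟨ℓ, hbℓ, hKoly, hidx, h32, v, 𝔓, h, hℓv, h𝔓, hh, hFE, hne, w, 𝔔, τ, hwv, hℓw, h𝔔w, hτ, hresτ⟩ :=
    exists_kolyvaginPrime_deep_sq_smul_sub_ne_of_smul_eq_neg W hK hc₀ hce hc₀R hR hQ'Q2 hQQ2 hHopen hHn hHW hHK hHQ' hN' hirr b
  refine ⟨ℓ, hbℓ, hKoly, hidx, h32, w, 𝔔, τ, hℓw, h𝔔w, hτ, fun h0 ↦ hne ?_⟩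
  -- `τ·Q − Q = θ (h·h·QQ − QQ)`
  have hτQ : τ • Q = θ ((h * h) • QQ) := by
    rw [← hresτ, RatClosure.pointsEquiv_smul, hQQ, AddEquiv.apply_symm_apply]
  have : θ (h • h • QQ - QQ) = 0 := by
    rw [map_sub, ← mul_smul, ← hτQ, hQQ, AddEquiv.apply_symm_apply, h0]
  exact (map_eq_zero_iff _ θ.injective).mp this

/-- ★★★ **THE SAME WITH «QUARTER MOVED» DISCHARGED**: on the Theorem-B₂ frame (`ρ_{E,2^n}` onto for all `n`, `d_K` odd, the two non-squares), a
`K`-point `R ∉ 2E(K)` with `c·R = −R` whose half `Q'` is fixed by `Γ_{K(E[4])}` (the (β) bit) admits, beyond every bound, a deep `FrobEqFrobInfty`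
Kolyvagin prime of K4Neg's witness type at which the level-`4` Kummer class of `R` is alive: `τ·Q − Q ≠ 0` for an arithmetic Frobenius `τ ∈ Γ_K` at the
place over `ℓ` and ANY quarter `Q` of `R` over `Q'` (`OneBitDescent.forall_exists_torsionFixing_smul_ne_of_not_two_dvd` supplies the mover).
BSD / `K4Neg` NOT proved by this. [cite: McCallumLMS1991, §3 Cor. 3.2] [cite: GrossLMS1991, §9 Prop. 9.6] [cite: LawsonWuthrich2016, §7.1] -/
theorem exists_kolyvaginPrime_deep_smul_sub_ne_of_kFrame_of_not_two_dvd (hK : IsImaginaryQuadratic K)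
    (hodd : Odd (NumberField.discr K)) (hsq1 : ¬ IsSquare ((NumberField.discr K : ℚ) * -|W.Δ|))
    (hsq2 : ¬ IsSquare ((NumberField.discr K : ℚ) * (-(2 * |W.Δ|)))) (hρ : ∀ n : ℕ, 0 < n → W.HasSurjectiveModNGaloisRep ((2 : ℤ) ^ n))
    (hΔ : W.Δ < 0) {c₀ : absoluteGaloisGroup ℚ} (hc₀ : IsComplexConjugation (Rat.castHom ℝ) c₀) {c : K ≃ₐ[ℚ] K} (hc : c ≠ 1)
    (R : (W.baseChange K).toAffine.Point) (hcR : c • R = -R) (hR2 : ¬ ∃ R' : (W.baseChange K).toAffine.Point, (2 : ℤ) • R' = R)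
    (Q' Q : geomPoints (W.baseChange K)) (hQ' : (2 : ℤ) • Q' = toGeomPoints (W.baseChange K) R) (hQ : (2 : ℤ) • Q = Q')
    (hent : ∀ ρ ∈ torsionFixing (W.baseChange K) ((2 ^ 2 : ℕ) : ℤ), ρ • Q' = Q') (b : ℕ) :
    ∃ ℓ : ℕ, b < ℓ ∧ Zhang2014.IsKolyvaginPrime (W.conductorNorm ℤ) W K 2 ℓ ∧ 2 ≤ Zhang2014.kolyvaginIndex W 2 ℓ ∧
      FrobEqFrobInfty W K (2 ^ 2) ℓ ∧
      ∃ (w : HeightOneSpectrum (𝓞 K)) (𝔔 : Ideal (absIntegers (𝓞 K) K)) (τ : absoluteGaloisGroup K),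
        (ℓ : 𝓞 K) ∈ w.asIdeal ∧ 𝔔 ∈ w.primesAbove ∧ IsArithFrobAt (𝓞 K) τ 𝔔 ∧ τ • Q - Q ≠ 0 := by
  have hsurj : W.HasSurjectiveModNGaloisRep 2 := by simpa using hρ 1 one_pos
  have hQ4 : (4 : ℤ) • Q = toGeomPoints (W.baseChange K) R := by
    rw [show (4 : ℤ) = 2 * 2 by norm_num, mul_smul, hQ, hQ']
  have hN : ∃ ρ ∈ torsionFixing (W.baseChange K) ((2 ^ 2 : ℕ) : ℤ), ρ • Q ≠ Q :=
    OneBitDescent.forall_exists_torsionFixing_smul_ne_of_not_two_dvd W K hK hodd hsq1 hsq2 hρ hR2 (L := 2) le_rfl Q hQ4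
  exact exists_kolyvaginPrime_deep_smul_sub_ne_of_kFrame W hK hsurj hΔ hc₀ hc R hcR Q' Q hQ' hQ hent hN b

end Summit.BirchSwinnertonDyer.BirchSwinnertonDyer.Theorems.GenusExact.Lw2PhantomExclusion.DeepPrimeOneBit

end
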